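import Literature.AlgebraicGeometry.Resolution.GaloisNormalizationFields
import Literature.AlgebraicGeometry.Resolution.NormalizationInNormal
import Literature.AlgebraicGeometry.Resolution.NormalizationInSeparable
import Literature.AlgebraicGeometry.Resolution.PullbackResidueFields
import HarnessLib

/-!
# De Jong's alteration theorem, 4.16 PROVED: the Galois normalisation of the base

Topic: `Literature/AlgebraicGeometry/Resolution`. DISCHARGE of the named fact
`DeJong1996GaloisNormalization` (`AlterationsStrictTransform.lean`; de Jong 1996, 4.16), one of
the four open leaves of 4.13–4.22 (`DeJong1996FibrationToSemiStablePair.of_printedLeaves`):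

> "4.16. Assume (i)–(iv), (vi) a)–e). Let `Z = ⋃ᵢ₌₁ⁿ Zᵢ` be the decomposition into irreducible
> components of `Z`. Choose a finite separable Galois extension `k(Y) ⊂ L` such that `k(Zᵢ)`
> may be embedded over `k(Y)` into `L` for all `i`; this is possible as the field extensions
> `k(Y) ⊂ k(Zᵢ)` are finite separable by (vi) d). Let `Y'` be the normalization of `Y` in the
> field `L`, then `ψ : Y' → Y` is a (finite) generically étale alteration of `Y`. Constructing
> `(X', Z')` as in 4.15, we see that `Z' = Z'₁ ∪ … ∪ Z'ₙ` with `Z'ᵢ → Y'` finite and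
> birational. (Any component of `Z'` dominates `Y'` as `Z'` has pure codimension 1 in `X'` in
> view of (iv).)" (p. 71)

The proof assembled here (`DeJong1996GaloisNormalization_holds`):

* `L ⊇ κ(η)` is the finite Galois extension splitting the residue fields `κ(ξ)`, `ξ ∈ Z` over the
  generic point `η` of `Y` (`exists_galoisField_splits_residueField`), and `Y' = Y^L`,
  `ψ : Y' → Y` the normalization of `Y` in `L`: finite (E. Noether), a generically étale
  alteration (`L/K(Y)` separable, 2.20), projective and normal (`NormalizationInNormal.lean`);
* for the reduction `ι : X' ↪ X ×_Y Y'` and a component `C` of `Z' = φ⁻¹(Z)`: `C_red → Y'` is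
  **finite** (a closed subscheme of `Z_red ×_Y Y'`), and **"any component of `Z'` dominates `Y'`"**:
  `X'` is integral and `Z'` is the support of a Cartier divisor (4.15, proved in
  `AlterationsStrictTransformHolds.lean`), so the generic point `ζ` of `C` has coheight `≤ 1`
  (Krull) and maps to the generic point `η'` of `Y'` (`apply_eq_genericPoint_of_coheight_le_one`);
* **birational**: `φ(ζ) = ξ ∈ Z` lies over `η`, and `κ(ζ) = κ(ι ζ)` is a compositum of `κ(ξ)` and
  `κ(η') = L` over `κ(η)` (`Scheme.Pullback.residueFieldMap_snd_surjective_of_range_subset`);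
  as the minimal polynomials of `κ(ξ)/κ(η)` split in `L`, the image of `κ(ξ)` lies in the image
  of `L` (`range_subset_range_of_splits_minpoly`), so `κ(η') → κ(ζ)` is onto: the finite
  dominant `C_red → Y'` induces an isomorphism of function fields, hence — `Y'` being normal —
  is an isomorphism (`isIso_morphismRestrict_of_isIntegralHom_of_isIso_stalkMap`), in particular
  birational.

No new named facts; with `DeJong1996StrictTransform_holds` (4.15) this also discharges the named
fact `DeJong1996SectionsReduction` (4.15–4.16, `AlterationsSections.lean`):
`DeJong1996SectionsReduction_holds`.

## Sources

* A. J. de Jong, *Smoothness, semi-stability and alterations*, Publ. Math. IHÉS 83 (1996) 51–93: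
  2.20 (p. 61), 4.15–4.16 (p. 71). [DeJong1996]
* Q. Liu, *Algebraic Geometry and Arithmetic Curves* (2002), Def. 4.1.24, Prop. 4.1.27,
  Cor. 4.4.3. [Liu2002]
* The Stacks Project, Tags 01JT, 0AB1, 0BRK.
-/

noncomputable section

open CategoryTheory CategoryTheory.Limits AlgebraicGeometry TopologicalSpace Topology

namespace Literature.AlgebraicGeometry.Resolution

universe u

/-! ## Residue fields: the two small transports -/

section ResidueFields

/-- From `κ(ψ y₀) → κ(y₀) → L` being the structure map (up to the identification `ψ y₀ = η`) and
`κ(y₀) → L` bijective, we get, at any point `y = y₀`, a ring map `m : L → κ(y)` through which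
`κ(η) → κ(y)` (along `ψ y = η`) factors as `m ∘ (κ(η) → L)`. [folklore] -/
theorem exists_ringHom_residueField_of_comp_eq {Y Y' : Scheme.{u}} (ψ : Y' ⟶ Y) {y₀ y : Y'}
    (hyy : y₀ = y) {η : Y} (e : ψ y₀ = η) (L : Type u) [Field L]
    [Algebra (Y.residueField η) L] (φ : Y'.residueField y₀ ⟶ CommRingCat.of L)
    (hφ : Function.Bijective φ)
    (hcompat : ψ.residueFieldMap y₀ ≫ φ =
      (Y.residueFieldCongr e).hom ≫ CommRingCat.ofHom (algebraMap (Y.residueField η) L)) :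
    ∃ (hy : ψ y = η) (m : L →+* Y'.residueField y),
      ∀ c : Y.residueField η,
        m (algebraMap (Y.residueField η) L c) =
          ψ.residueFieldMap y ((Y.residueFieldCongr hy).inv c) := by
  subst hyy
  refine ⟨e, (RingEquiv.ofBijective φ.hom hφ).symm.toRingHom, fun c => ?_⟩
  apply (RingEquiv.ofBijective φ.hom hφ).injective
  rw [RingEquiv.toRingHom_eq_coe, RingEquiv.coe_toRingHom, RingEquiv.apply_symm_apply,
    RingEquiv.ofBijective_apply]
  change _ = (ψ.residueFieldMap y₀ ≫ φ) ((Y.residueFieldCongr e).inv c)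
  rw [hcompat, CommRingCat.comp_apply, ← CommRingCat.comp_apply (Y.residueFieldCongr e).inv,
    Iso.inv_hom_id]
  rfl

/-- The two ways `κ(η) → κ(p)` around the fibre square, for a point `p` of `X ×_Y Y'` with both
projections over `η`. [folklore] -/
theorem residueFieldCongr_inv_residueFieldMap_fst_eq {X Y Y' : Scheme.{u}} (f : X ⟶ Y)
    (ψ : Y' ⟶ Y) (p : ↥(pullback f ψ)) {η : Y} (hx : f (pullback.fst f ψ p) = η)
    (hy : ψ (pullback.snd f ψ p) = η) :
    (Y.residueFieldCongr hx).inv ≫ f.residueFieldMap (pullback.fst f ψ p) ≫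
        (pullback.fst f ψ).residueFieldMap p =
      (Y.residueFieldCongr hy).inv ≫ ψ.residueFieldMap (pullback.snd f ψ p) ≫
        (pullback.snd f ψ).residueFieldMap p := by
  subst hx
  have key := Scheme.Pullback.residueFieldCongr_inv_residueFieldMap_ofPoint p
  simp only [Category.assoc] at key
  exact key

/-- **The residue field of a point `p` of `X ×_Y Y'` over `ξ ∈ X` and `y ∈ Y'` is generated by
`κ(y)` when the minimal polynomials of `κ(ξ)/κ(η)` split in a field `L` mapping to `κ(y)`
compatibly** (de Jong 1996, 4.16: the components of `Zᵢ ×_Y Y'` over the Galois normalisation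
are birational to `Y'`): with `η = f ξ = ψ y` the generic point in the application, `κ(ξ)`
algebraic over `κ(η)` with all minimal polynomials split in `L`, and `m : L → κ(y)` compatible
with `κ(η)`, the map `κ(y) → κ(p)` is surjective — the image of `κ(ξ) → κ(p)` consists of roots
of those polynomials, all of which lie in the image of `L`, hence of `κ(y)` (Stacks 01JT:
`κ(p)` is a compositum of `κ(ξ)` and `κ(y)`). [cite: DeJong1996, 4.16, p. 71] -/
theorem residueFieldMap_snd_surjective_of_splits {X Y Y' : Scheme.{u}} (f : X ⟶ Y) (ψ : Y' ⟶ Y)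
    (p : ↥(pullback f ψ)) {η : Y} (hx : f (pullback.fst f ψ p) = η)
    (hy : ψ (pullback.snd f ψ p) = η) (L : Type u) [Field L] [Algebra (Y.residueField η) L]
    (halg : letI := ((Y.residueFieldCongr hx).inv ≫
        f.residueFieldMap (pullback.fst f ψ p)).hom.toAlgebra
      Algebra.IsAlgebraic (Y.residueField η) (X.residueField (pullback.fst f ψ p)) ∧
        ∀ t : X.residueField (pullback.fst f ψ p),
          ((minpoly (Y.residueField η) t).map (algebraMap (Y.residueField η) L)).Splits)
    (m : L →+* Y'.residueField (pullback.snd f ψ p))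
    (hm : ∀ c : Y.residueField η, m (algebraMap (Y.residueField η) L c) =
      ψ.residueFieldMap (pullback.snd f ψ p) ((Y.residueFieldCongr hy).inv c)) :
    Function.Surjective ((pullback.snd f ψ).residueFieldMap p) := by
  letI alg : Algebra (Y.residueField η) (X.residueField (pullback.fst f ψ p)) :=
    ((Y.residueFieldCongr hx).inv ≫ f.residueFieldMap (pullback.fst f ψ p)).hom.toAlgebra
  haveI := halg.1
  apply Scheme.Pullback.residueFieldMap_snd_surjective_of_range_subset f ψ p
  -- `r' : L → κ(y) → κ(p)`
  set r' : L →+* (pullback f ψ).residueField p :=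
    ((pullback.snd f ψ).residueFieldMap p).hom.comp m with hr'
  have hsub : Set.range ((pullback.fst f ψ).residueFieldMap p).hom ⊆ Set.range r' := by
    refine range_subset_range_of_splits_minpoly (K := Y.residueField η)
      (algebraMap (Y.residueField η) L) ((pullback.fst f ψ).residueFieldMap p).hom r' ?_ halg.2
    -- compatibility over `κ(η)`: both sides are `κ(η) → κ(p)`
    have key := residueFieldCongr_inv_residueFieldMap_fst_eq f ψ p hx hy
    ext c
    have key' := DFunLike.congr_fun (congrArg CommRingCat.Hom.hom key) c
    simp only [CommRingCat.hom_comp, RingHom.comp_apply] at key'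
    rw [RingHom.comp_apply, RingHom.comp_apply, hr', RingHom.comp_apply, hm,
      RingHom.algebraMap_toAlgebra, CommRingCat.hom_comp, RingHom.comp_apply]
    exact key'
  intro t ht
  obtain ⟨l, hl⟩ := hsub ht
  exact ⟨m l, hl⟩

end ResidueFields

/-! ## 4.16 PROVED -/

open Scheme.IdealSheafData DeJong1996 in
/-- **de Jong 1996, 4.16 — the named fact `DeJong1996GaloisNormalization` PROVED** (see the
module docstring for the proof). [cite: DeJong1996, 4.16, p. 71] -/
theorem DeJong1996GaloisNormalization_holds : DeJong1996GaloisNormalization.{u} := by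
  intro k _ _ X Y _ f _ g Z hP _
  classical
  -- instances carried by the fibred pair
  haveI := hP.isIntegral
  haveI : Surjective f := hP.isCurveFibration.surjective
  haveI : GeometricallyConnected f := hP.isCurveFibration.geometricallyConnected
  haveI : IsProper g :=
    Literature.AlgebraicGeometry.Motives.IsProjectiveOver.isProper (X := Over.mk g)
      hP.isProjectiveOver_base
  haveI := hP.locallyOfFiniteType
  haveI := hP.quasiCompact
  haveI : IsLocallyNoetherian X := LocallyOfFiniteType.isLocallyNoetherian (f ≫ g)
  haveI : CompactSpace X := QuasiCompact.compactSpace_of_compactSpace (f ≫ g)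
  haveI : IsNoetherian X := {}
  have hZ : IsClosed Z := hP.isClosed
  -- the Galois extension `L ⊇ κ(η)` splitting the residue fields of `Z` over `η`
  obtain ⟨L, _, _, hLfin, hLgal, hsplit⟩ :=
    exists_galoisField_splits_residueField f hZ hP.isFiniteGenericallyEtaleOn
  haveI := hLfin
  haveI := hLgal
  letI algKY : Algebra Y.functionField L :=
    ((algebraMap (Y.residueField (genericPoint Y)) L).comp (Y.residue (genericPoint Y)).hom).toAlgebra
  obtain ⟨hfinKY, hsepKY⟩ := finite_isSeparable_functionField_of_residueField Y L
  haveI := hfinKY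
  haveI := hsepKY
  -- `Y' = Y^L`, `ψ : Y' → Y`
  haveI : IsFinite (normalizationInι Y L) := isFinite_normalizationInι Y L g
  obtain ⟨-, hψalt, hψet⟩ := isAlteration_and_isGenericallyEtale_normalizationInι Y L g
  haveI : IsProper (normalizationInι Y L) := hψalt.isProper
  haveI : Surjective (normalizationInι Y L) := hψalt.surjective
  haveI : IsDominant (normalizationInι Y L) := hψalt.isDominant
  have hproj := isProjectiveOver_normalizationIn L g hP.isProjectiveOver_base
  have hnorm := isIntegrallyClosed_stalk_normalizationIn Y L
  have hδ : Y.descResidueField (CommRingCat.ofHom (algebraMap Y.functionField L)) =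
      CommRingCat.ofHom (algebraMap (Y.residueField (genericPoint Y)) L) := by
    rw [← cancel_epi (Y.residue (genericPoint Y)), Scheme.residue_descResidueField]
    rfl
  set Y' := normalizationIn Y L with hY'
  set ψ := normalizationInι Y L with hψ
  obtain ⟨y₀, φ, e, hy₀, hφbij, hcompat⟩ := exists_residueFieldMap_normalizationIn Y L
  rw [hδ] at hcompat
  refine ⟨Y', inferInstance, ψ, inferInstance, hψalt, hψet, hproj, hnorm, ?_⟩
  -- the components of `Z'`
  intro X' ι _ _ _ C hC
  set f' := ι ≫ pullback.snd f ψ with hf'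
  set Z' : Set X' := (ι ≫ pullback.fst f ψ) ⁻¹' Z with hZ'def
  have hZ' : IsClosed Z' := hZ.preimage (ι ≫ pullback.fst f ψ).continuous
  -- `C` is closed
  have hCcl : IsClosed C := by
    have h := hC.2 ⟨hC.1.1.closure, closure_minimal hC.1.2 hZ'⟩ subset_closure
    exact closure_subset_iff_isClosed.mp h
  refine ⟨hCcl, ?_⟩
  -- instances on `Y'`, `X ×_Y Y'`, `X'`
  haveI : IsProper (ψ ≫ g) := inferInstance
  haveI : IsLocallyNoetherian Y' := LocallyOfFiniteType.isLocallyNoetherian (ψ ≫ g)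
  haveI : IsLocallyNoetherian (pullback f ψ) :=
    LocallyOfFiniteType.isLocallyNoetherian (pullback.snd f ψ)
  haveI : IsLocallyNoetherian X' := LocallyOfFiniteType.isLocallyNoetherian ι
  haveI : LocallyOfFinitePresentation f' := inferInstance
  haveI : Surjective f' := by rw [hf']; infer_instance
  haveI : Nonempty X' := by
    obtain ⟨x, -⟩ := f'.surjective (Classical.arbitrary Y')
    exact ⟨x⟩
  haveI : IsIntegral X' := DeJong1996.StrictTransform.isIntegral f ψ ι
    hP.isCurveFibration.smooth_fiberToSpecResidueField_genericPoint
    hP.isCurveFibration.dense_preimage_smoothLocus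
  have hdim' := DeJong1996.StrictTransform.topologicalKrullDim_fiber_comp_snd f ψ ι
    hP.isCurveFibration.topologicalKrullDim_eq_one
  obtain ⟨I', hI'c, hI'Z⟩ :=
    DeJong1996.StrictTransform.exists_isEffectiveCartier f ψ ι hP.exists_isEffectiveCartier
  -- `T = Z_red ×_Y Y'`, finite over `Y'`, with its closed immersion `m` into `X ×_Y Y'`
  set zι := (vanishingIdeal (⟨Z, hZ⟩ : Closeds X)).subschemeι with hzι
  have eZ : (⟨closure Z, isClosed_closure⟩ : Closeds X) = ⟨Z, hZ⟩ := by
    ext1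
    exact hZ.closure_eq
  haveI : IsFinite (zι ≫ f) := by
    have h := hP.isFiniteGenericallyEtaleOn.1
    rw [eZ] at h
    exact h
  obtain ⟨m, hm, hmsnd, -, hmrange⟩ :=
    DeJong1996.StrictTransform.exists_pullback_vanishingIdeal_to_pullback f ψ hZ
  haveI := hm
  have hfin' : ∀ y' : Y', (Z' ∩ f' ⁻¹' {y'}).Finite := fun y' => by
    have hF := ((pullback.snd (zι ≫ f) ψ).finite_preimage_singleton y').image m
    refine (hF.preimage ι.isClosedEmbedding.injective.injOn).subset ?_
    rintro x ⟨hxZ, hxy⟩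
    obtain ⟨t, ht⟩ : ι x ∈ Set.range m := by rw [hmrange]; exact hxZ
    refine ⟨t, ?_, ht⟩
    show pullback.snd (zι ≫ f) ψ t ∈ ({y'} : Set Y')
    rw [← hmsnd, Scheme.Hom.comp_apply, ht]
    exact hxy
  -- the component `C_red` and its generic point `ζ`
  set cι := (vanishingIdeal (⟨C, hCcl⟩ : Closeds X')).subschemeι with hcι
  haveI : IsIntegral (vanishingIdeal (⟨C, hCcl⟩ : Closeds X')).subscheme :=
    isIntegral_subscheme_vanishingIdeal ⟨C, hCcl⟩ hC.1.1
  set ζ : X' := cι (genericPoint (vanishingIdeal (⟨C, hCcl⟩ : Closeds X')).subscheme) with hζdef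
  have hζC : ζ ∈ C := mem_of_subscheme_vanishingIdeal (⟨C, hCcl⟩ : Closeds X') _
  have hζgen : IsGenericPoint ζ C := by
    have h := (genericPoint_spec (vanishingIdeal (⟨C, hCcl⟩ : Closeds X')).subscheme).image
      cι.continuous
    rw [Set.image_univ, range_subschemeι_vanishingIdeal] at h
    change IsGenericPoint ζ (closure C) at h
    rwa [hCcl.closure_eq] at h
  have hζZ' : ζ ∈ Z' := hC.1.2 hζC
  -- CLAIM A: "any component of `Z'` dominates `Y'`"
  have hfζ : f' ζ = genericPoint Y' := by
    have hζsupp : ζ ∈ I'.support := by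
      show ζ ∈ (I'.support : Set X')
      rw [hI'Z]
      exact hζZ'
    obtain ⟨ξ, hξsupp, hξζ, hξco⟩ := hI'c.exists_specializes_coheight_le_one hζsupp
    have hξZ' : ξ ∈ Z' := by
      have : ξ ∈ (I'.support : Set X') := hξsupp
      rwa [hI'Z] at this
    -- `ξ = ζ` by maximality of `C`
    have hCξ : C ⊆ closure {ξ} := by
      rw [← hζgen.def]
      exact closure_minimal (Set.singleton_subset_iff.mpr (specializes_iff_mem_closure.mp hξζ))
        isClosed_closure
    have hξC : closure {ξ} ⊆ C :=
      hC.2 ⟨isIrreducible_singleton.closure,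
        closure_minimal (Set.singleton_subset_iff.mpr hξZ') hZ'⟩ hCξ
    have hζξ : ζ ⤳ ξ := by
      rw [specializes_iff_mem_closure, hζgen.def]
      exact hξC (subset_closure rfl)
    have hξeq : ξ = ζ := (hξζ.antisymm hζξ).eq
    rw [hξeq] at hξco
    exact apply_eq_genericPoint_of_coheight_le_one f' hdim' hZ' hfin' hζZ' hξco
  -- CLAIM B: `κ(η') → κ(ι ζ)` is onto
  set p : ↥(pullback f ψ) := ι ζ with hpdef
  have hy : ψ (pullback.snd f ψ p) = genericPoint Y := by
    have h1 : pullback.snd f ψ p = genericPoint Y' := hfζ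
    rw [h1]
    exact genericPoint_eq_of_isDominant ψ
  have hx : f (pullback.fst f ψ p) = genericPoint Y := by
    rw [← Scheme.Hom.comp_apply, pullback.condition, Scheme.Hom.comp_apply]
    exact hy
  have hxZ : pullback.fst f ψ p ∈ Z := hζZ'
  have hyy : y₀ = pullback.snd f ψ p := by
    rw [hy₀]
    exact hfζ.symm
  obtain ⟨hy', mL, hmL⟩ := exists_ringHom_residueField_of_comp_eq ψ hyy e L φ hφbij hcompat
  have hsurj : Function.Surjective ((pullback.snd f ψ).residueFieldMap p) :=
    residueFieldMap_snd_surjective_of_splits f ψ p hx hy' L (hsplit _ hxZ hx) mL hmL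
  -- `g₁ = C_red → Y'` is finite: a closed subscheme of `T = Z_red ×_Y Y'`
  set g₁ := cι ≫ ι ≫ pullback.snd f ψ with hg₁
  have hrange : Set.range (cι ≫ ι) ⊆ Set.range m := by
    rintro _ ⟨w, rfl⟩
    rw [hmrange]
    show pullback.fst f ψ (ι (cι w)) ∈ Z
    exact hC.1.2 (mem_of_subscheme_vanishingIdeal (⟨C, hCcl⟩ : Closeds X') w)
  let ℓ := IsClosedImmersion.liftOfRange m (cι ≫ ι) hrange
  have hℓ : ℓ ≫ m = cι ≫ ι := IsClosedImmersion.liftOfRange_fac _ _ _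
  haveI : IsClosedImmersion ℓ := by
    have : IsClosedImmersion (ℓ ≫ m) := by rw [hℓ]; infer_instance
    exact IsClosedImmersion.of_comp_isClosedImmersion ℓ m
  have hg₁ℓ : g₁ = ℓ ≫ pullback.snd (zι ≫ f) ψ := by
    rw [hg₁, ← hmsnd, ← Category.assoc ℓ m, hℓ, Category.assoc]
  haveI hg₁fin : IsFinite g₁ := by rw [hg₁ℓ]; infer_instance
  refine ⟨hg₁fin, ?_⟩
  -- the stalk map of `g₁` at the generic point `γ` of `C_red` is an isomorphism
  have hg₁γ : g₁ (genericPoint _) = genericPoint Y' := hfζ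
  haveI : IsDominant g₁ := by
    refine ⟨Dense.mono ?_ (dense_iff_closure_eq.mpr (genericPoint_closure (α := ↥Y')))⟩
    rintro _ rfl
    exact ⟨_, hg₁γ⟩
  have hstalk : IsIso (g₁.stalkMap (genericPoint _)) := by
    set γ := genericPoint (vanishingIdeal (⟨C, hCcl⟩ : Closeds X')).subscheme with hγ
    -- surjective: `κ(η') → κ(ι ζ) → κ(ζ) → κ(γ)` is onto and `𝒪_{C_red, γ} = κ(γ)`
    have hs1 : Function.Surjective (g₁.residueFieldMap γ) := by
      rw [hg₁, Scheme.residueFieldMap_comp, Scheme.residueFieldMap_comp]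
      exact ((Scheme.Hom.residueFieldMap_surjective cι γ).comp
        (Scheme.Hom.residueFieldMap_surjective ι _)).comp hsurj
    haveI := isIso_residue_genericPoint (vanishingIdeal (⟨C, hCcl⟩ : Closeds X')).subscheme
    have hs : Function.Surjective (g₁.stalkMap γ) := by
      intro t
      obtain ⟨s, hs⟩ := (hs1.comp (Y'.residue_surjective (g₁ γ)))
        ((vanishingIdeal (⟨C, hCcl⟩ : Closeds X')).subscheme.residue γ t)
      refine ⟨s, ?_⟩
      have hinj : Function.Injective ((vanishingIdeal (⟨C, hCcl⟩ : Closeds X')).subscheme.residue γ) :=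
        (asIso ((vanishingIdeal (⟨C, hCcl⟩ : Closeds X')).subscheme.residue γ)).commRingCatIsoToRingEquiv.injective
      apply hinj
      rw [← hs, Function.comp_apply, ← CommRingCat.comp_apply, ← CommRingCat.comp_apply,
        Scheme.residue_residueFieldMap]
    have hfield : IsField (Y'.presheaf.stalk (g₁ γ)) := by
      rw [hg₁γ]
      exact Field.toIsField Y'.functionField
    letI := hfield.toField
    have hbij : Function.Bijective (g₁.stalkMap γ) := ⟨(g₁.stalkMap γ).hom.injective, hs⟩
    let eγ := RingEquiv.ofBijective _ hbij
    change IsIso eγ.toCommRingCatIso.hom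
    infer_instance
  -- hence `g₁` is an isomorphism (`Y'` is normal), in particular birational
  haveI : IsIso g₁ := by
    have key : MorphismProperty.isomorphisms Scheme g₁ := by
      refine (IsZariskiLocalAtTarget.iff_of_iSup_eq_top
        (P := MorphismProperty.isomorphisms Scheme) _ (iSup_nonempty_affineOpens_eq_top Y')).mpr ?_
      rintro ⟨V, hVne⟩
      show IsIso (g₁ ∣_ (V : Y'.Opens))
      haveI := hVne
      exact isIso_morphismRestrict_of_isIntegralHom_of_isIso_stalkMap g₁ hnorm hstalk V
    exact key
  refine ⟨⊤, by simp [dense_univ], by simp [dense_univ], ?_⟩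
  exact IsZariskiLocalAtTarget.restrict (P := MorphismProperty.isomorphisms Scheme)
    (show MorphismProperty.isomorphisms Scheme g₁ from ‹IsIso g₁›) ⊤

/-- **de Jong 1996, 4.15–4.16 (`DeJong1996SectionsReduction`) PROVED**: the strict transform
4.15 (`DeJong1996StrictTransform_holds`) and the Galois normalisation 4.16
(`DeJong1996GaloisNormalization_holds`). [cite: DeJong1996, 4.15–4.16, p. 71] -/
theorem DeJong1996SectionsReduction_holds : DeJong1996SectionsReduction.{u} :=
  DeJong1996SectionsReduction.of_galoisNormalization DeJong1996GaloisNormalization_holds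

end Literature.AlgebraicGeometry.Resolution

end
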